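import Summits.ValiantsHypothesis.ValiantsHypothesis.Theorems.KPlusLogSqLawWeakLiftingTowerGraftTwoSidedThreeLettersLaw

/-!
# Tower graft line — THE TWO-SIDED THREE-LETTER LAW, part D: `Z₊ ≤ 2m` for DEFINITE-TYPE roots (any corank)

Part D of `…TowerGraftTwoSidedThreeLetters.lean` (crux `stmt-ValiantsHypothesis-19561`, line (B) `tower_graft`, two-sided word
instrument; seat val-sym-lift-p3 g20, `--supports 19561`, NO stub claimed).  Part B proved the `2m` law for SIMPLE CROSSINGS
(one-dimensional kernels).  Here the one-dimensional-kernel hypothesis is dropped: it suffices that every positive root of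
`det (X^d A + X^{d+e} J + X^{d+3e} B)` (`A ≻ 0`, `B ≻ 0`, `J` any symmetric, `e ≥ 1`) is of DEFINITE TYPE — the kernel form
`u ↦ P_u′(t)` is definite on `ker F(t)`, exactly the hypothesis of the inertia kit's GLOBAL INDEX FORMULA (`Inertia.global_index_formula`,
seat mdr-p2) — and then the positive roots counted WITH MULTIPLICITY number at most `2m` (`card_posRoots_le_two_mul_of_definite`).

New ingredients: `exists_kernel_orthogonal_family` — `ker M` has `m − rank M` linearly independent vectors pairwise orthogonal for any
given symmetric form (Mathlib's `LinearMap.BilinForm.exists_orthogonal_basis` + rank–nullity); `card_posType_family_le_rank` — the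
Gram–Cauchy bound of part A for kernel FAMILIES with repeated scales, provided two vectors at the same scale are orthogonal for the form
`B − A/(2t^{3e})` (the Cauchy matrix at repeated nodes is still positive semidefinite, so the decomposition
`Gram_B = D⁻¹(Gram_A ⊙ Cauchy)D⁻¹ + diag` survives).  At a positive-type root of corank `c` such a family of size `c` exists, so
`N⁺ = ∑ corank ≤ rank B` (`Inertia.sum_corank_eq_card_roots_filter`) and `Z₊ = N⁺ + N⁻ = 2N⁺ ≤ 2m`.

HONEST FRAMING as in parts A–C: a structural law for THREE letters on the supports `(d, d+e, d+3e)`; degenerate (non-definite) roots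
are not covered (the kit's index formula needs definite type); nothing on the four-letter column, S4/S4b/S4d/S4f/S5, `TowerB`,
`WeakLifting` in its window, Conjecture B, `MatrixDescartes` (18050) or `VP ≠ VNP`.  Def-free; axioms standard.

[folklore] orthogonal bases of symmetric forms; the tree's inertia kit ([GohbergLancasterRodman2005, §12.4–12.5]).
-/

set_option linter.dupNamespace false
set_option autoImplicit false

namespace Summit.ValiantsHypothesis.ValiantsHypothesis.Theorems.KPlusLogSqLaw.TowerGraft

open Matrix
open scoped BigOperators

namespace TwoSidedThree

/-! ## §5 Dropping the one-dimensional-kernel hypothesis: definite type suffices -/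

section Definite

open Polynomial
open Summit.ValiantsHypothesis.ValiantsHypothesis.Theorems.LacunarySymmetroidMatrixDescartes

variable {m : ℕ}

/-- **Orthogonal kernel families.**  For a real `m × m` matrix `M` and a symmetric matrix `Φ` there are `m − rank M` linearly
independent kernel vectors of `M` which are pairwise `Φ`-orthogonal (an orthogonal basis of `ker M` for the symmetric form
`x ⬝ᵥ Φ y`; Mathlib's `LinearMap.BilinForm.exists_orthogonal_basis`). [folklore] -/
theorem exists_kernel_orthogonal_family (M Φ : Matrix (Fin m) (Fin m) ℝ) (hΦ : Φ.IsSymm) :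
    ∃ v : Fin (m - M.rank) → (Fin m → ℝ), (∀ j, M *ᵥ v j = 0) ∧ (∀ j, v j ≠ 0) ∧
      ∀ j j', j ≠ j' → v j ⬝ᵥ (Φ *ᵥ v j') = 0 := by
  classical
  haveI : Invertible (2 : ℝ) := invertibleOfNonzero two_ne_zero
  -- the form `Φ` restricted to the kernel `K = ker M`
  let Bf : LinearMap.BilinForm ℝ (LinearMap.ker M.mulVecLin) :=
    (Matrix.toLinearMap₂' ℝ Φ).compl₁₂ (LinearMap.ker M.mulVecLin).subtype (LinearMap.ker M.mulVecLin).subtype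
  have hBf_apply : ∀ x y : LinearMap.ker M.mulVecLin, Bf x y = (x : Fin m → ℝ) ⬝ᵥ (Φ *ᵥ (y : Fin m → ℝ)) := by
    intro x y
    show (Matrix.toLinearMap₂' ℝ Φ) ((LinearMap.ker M.mulVecLin).subtype x) ((LinearMap.ker M.mulVecLin).subtype y) = _
    rw [Matrix.toLinearMap₂'_apply']
    rfl
  have hBsymm : LinearMap.IsSymm Bf := by
    rw [LinearMap.isSymm_def]
    intro x y
    show (RingHom.id ℝ) (Bf x y) = Bf y x
    rw [RingHom.id_apply, hBf_apply, hBf_apply, dotProduct_mulVec_symm hΦ, dotProduct_comm]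
  obtain ⟨w, hw⟩ := LinearMap.BilinForm.exists_orthogonal_basis hBsymm
  -- dimension count: `finrank (ker M) = m − rank M`
  have hdim : Module.finrank ℝ (LinearMap.ker M.mulVecLin) = m - M.rank := by
    have h := LinearMap.finrank_range_add_finrank_ker M.mulVecLin
    rw [Module.finrank_fin_fun] at h
    have hr : M.rank = Module.finrank ℝ (LinearMap.range M.mulVecLin) := rfl
    omega
  refine ⟨fun j => (w (Fin.cast hdim.symm j) : Fin m → ℝ), fun j => ?_, fun j => ?_, fun j j' hjj' => ?_⟩
  · have hmem := (w (Fin.cast hdim.symm j)).2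
    rw [LinearMap.mem_ker, Matrix.mulVecLin_apply] at hmem
    exact hmem
  · intro h0
    apply w.ne_zero (Fin.cast hdim.symm j)
    exact Subtype.ext h0
  · have hne : Fin.cast hdim.symm j ≠ Fin.cast hdim.symm j' := fun h => hjj' (by simpa using h)
    have h := LinearMap.isOrthoᵢ_def.mp hw _ _ hne
    rw [hBf_apply] at h
    exact h

variable {I : Type} [Fintype I] [DecidableEq I]

/-- **core bound for kernel FAMILIES** (repeated scales allowed): pairs `(τᵢ, uᵢ)` with `(A + τᵢ^e J + τᵢ^{3e} B)uᵢ = 0` of positive type,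
such that two vectors at the SAME scale are orthogonal for the form `B − A/(2τ^{3e})`; then `#I ≤ rank B`.  (Same Gram–Cauchy
decomposition; the Cauchy matrix at repeated nodes is still positive semidefinite.) [folklore] -/
theorem card_posType_family_le_rank (A J B : Matrix (Fin m) (Fin m) ℝ) (hA : A.PosSemidef) (hJ : J.IsSymm) (hB : B.PosSemidef)
    (e : ℕ) (τ : I → ℝ) (hτ : ∀ i, 0 < τ i) (he : 0 < e)
    (u : I → Fin m → ℝ) (hker : ∀ i, (A + τ i ^ e • J + (τ i ^ e) ^ 3 • B) *ᵥ u i = 0)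
    (htype : ∀ i, u i ⬝ᵥ (A *ᵥ u i) < 2 * (τ i ^ e) ^ 3 * (u i ⬝ᵥ (B *ᵥ u i)))
    (hsame : ∀ i k, i ≠ k → τ i = τ k →
      2 * (τ i ^ e) ^ 3 * (u i ⬝ᵥ (B *ᵥ u k)) = u i ⬝ᵥ (A *ᵥ u k)) :
    Fintype.card I ≤ B.rank := by
  classical
  have hAs : A.IsSymm := by
    have h1 := hA.1; unfold Matrix.IsHermitian at h1
    rwa [Matrix.conjTranspose_eq_transpose_of_trivial] at h1
  have hBs : B.IsSymm := by
    have h1 := hB.1; unfold Matrix.IsHermitian at h1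
    rwa [Matrix.conjTranspose_eq_transpose_of_trivial] at h1
  set s : I → ℝ := fun i => τ i ^ e with hsdef
  have hs : ∀ i, 0 < s i := fun i => pow_pos (hτ i) e
  have hsne : ∀ i k, τ i ≠ τ k → s i ≠ s k := by
    intro i k hik hcon
    apply hik
    exact (pow_left_inj₀ (hτ i).le (hτ k).le (Nat.pos_iff_ne_zero.mp he)).mp hcon
  set C : Matrix I I ℝ := Matrix.of fun i k : I => 1 / (s i + s k) with hCdef
  have hC : C.PosSemidef := posSemidef_cauchy s hs
  have hGA : (Matrix.of fun i' k' => u i' ⬝ᵥ (A *ᵥ u k')).PosSemidef := posSemidef_gram hA u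
  have hH : ((Matrix.of fun i' k' => u i' ⬝ᵥ (A *ᵥ u k')) ⊙ C).PosSemidef := hGA.hadamard hC
  set Dinv : Matrix I I ℝ := Matrix.diagonal fun i => (s i)⁻¹ with hDdef
  have hP : (Dinvᴴ * ((Matrix.of fun i' k' => u i' ⬝ᵥ (A *ᵥ u k')) ⊙ C) * Dinv).PosSemidef :=
    hH.conjTranspose_mul_mul_same Dinv
  have hDt : Dinvᴴ = Dinv := by
    rw [Matrix.conjTranspose_eq_transpose_of_trivial, hDdef, Matrix.diagonal_transpose]
  rw [hDt] at hP
  have hPapply : ∀ i k, (Dinv * ((Matrix.of fun i' k' => u i' ⬝ᵥ (A *ᵥ u k')) ⊙ C) * Dinv) i k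
      = (s i)⁻¹ * ((u i ⬝ᵥ (A *ᵥ u k)) * (1 / (s i + s k))) * (s k)⁻¹ := by
    intro i k
    simp only [hDdef, Matrix.mul_diagonal, Matrix.diagonal_mul, Matrix.hadamard_apply, hCdef, Matrix.of_apply]
  set Δ : I → ℝ := fun i => u i ⬝ᵥ (B *ᵥ u i) - (s i)⁻¹ * ((u i ⬝ᵥ (A *ᵥ u i)) * (1 / (s i + s i))) * (s i)⁻¹ with hΔdef
  have hΔpos : ∀ i, 0 < Δ i := by
    intro i
    have ht := htype i
    have hsi := hs i
    have hsi3 : 0 < (s i) ^ 3 := pow_pos hsi 3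
    show 0 < u i ⬝ᵥ (B *ᵥ u i) - (s i)⁻¹ * ((u i ⬝ᵥ (A *ᵥ u i)) * (1 / (s i + s i))) * (s i)⁻¹
    rw [show (s i)⁻¹ * (u i ⬝ᵥ (A *ᵥ u i) * (1 / (s i + s i))) * (s i)⁻¹
        = u i ⬝ᵥ (A *ᵥ u i) / (2 * (s i) ^ 3) by field_simp; ring]
    rw [sub_pos, div_lt_iff₀ (by positivity)]
    have : (τ i ^ e) ^ 3 = s i ^ 3 := rfl
    rw [this] at ht
    linarith
  have hdecomp : (Matrix.of fun i' k' => u i' ⬝ᵥ (B *ᵥ u k'))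
      = Dinv * ((Matrix.of fun i' k' => u i' ⬝ᵥ (A *ᵥ u k')) ⊙ C) * Dinv + Matrix.diagonal Δ := by
    ext i k
    rw [Matrix.add_apply, hPapply]
    by_cases hik : i = k
    · subst hik
      rw [Matrix.diagonal_apply_eq, Matrix.of_apply]
      simp only [hΔdef]
      ring
    · rw [Matrix.diagonal_apply_ne _ hik, add_zero]
      have h1 : s i + s k ≠ 0 := ne_of_gt (add_pos (hs i) (hs k))
      have h2 : s i ≠ 0 := ne_of_gt (hs i)
      have h3 : s k ≠ 0 := ne_of_gt (hs k)
      by_cases hτ' : τ i = τ k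
      · -- same scale: the hypothesis `hsame`
        have h4 := hsame i k hik hτ'
        have e1 : τ i ^ e = s i := rfl
        have hsk : s k = s i := by show τ k ^ e = τ i ^ e; rw [hτ']
        rw [e1] at h4
        rw [Matrix.of_apply, hsk, ← h4]
        field_simp
        ring
      · have hg := gramA_eq A J B e τ u hAs hJ hBs hker (hsne i k hτ')
        simp only [Matrix.of_apply] at hg
        rw [Matrix.of_apply, hg]
        have e1 : τ i ^ e = s i := rfl
        have e2 : τ k ^ e = s k := rfl
        rw [e1, e2]
        field_simp
  have hGBdef : (Matrix.of fun i' k' => u i' ⬝ᵥ (B *ᵥ u k')).PosDef := by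
    rw [Matrix.posDef_iff_dotProduct_mulVec]
    refine ⟨(posSemidef_gram hB u).1, fun x hx => ?_⟩
    rw [hdecomp, Matrix.add_mulVec, dotProduct_add]
    have h1 : 0 ≤ star x ⬝ᵥ ((Dinv * ((Matrix.of fun i' k' => u i' ⬝ᵥ (A *ᵥ u k')) ⊙ C) * Dinv) *ᵥ x) :=
      (Matrix.posSemidef_iff_dotProduct_mulVec.mp hP).2 x
    have h2 : 0 < star x ⬝ᵥ (Matrix.diagonal Δ *ᵥ x) := by
      rw [star_trivial]
      simp only [dotProduct, Matrix.mulVec_diagonal]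
      obtain ⟨i₀, hi₀⟩ := Function.ne_iff.mp hx
      apply Finset.sum_pos'
      · intro i _
        have := hΔpos i
        nlinarith [sq_nonneg (x i)]
      · refine ⟨i₀, Finset.mem_univ _, ?_⟩
        have := hΔpos i₀
        have hx0 : 0 < x i₀ ^ 2 := sq_pos_iff.mpr hi₀
        nlinarith
    linarith
  have hrank : (Matrix.of fun i' k' => u i' ⬝ᵥ (B *ᵥ u k')).rank = Fintype.card I :=
    Matrix.rank_of_isUnit _ hGBdef.isUnit
  rw [← hrank]
  exact rank_gram_le B u

/-- **THE `2m` LAW FOR DEFINITE-TYPE ROOTS** (no one-dimensional-kernel hypothesis).  `A ≻ 0`, `B ≻ 0`, `J` symmetric, `e ≥ 1`,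
`F(X) = X^d A + X^{d+e} J + X^{d+3e} B`; if every positive root of `det F` is of DEFINITE TYPE (the kernel form `u ↦ P_u′(t)` is
definite on `ker F(t)` — the hypothesis of the inertia kit's global index formula), then the positive roots of `det F` counted WITH
MULTIPLICITY number at most `2m`.  (At a positive-type root of corank `c` an orthogonal kernel basis for the form `B − A/(2t^{3e})`
feeds `c` pairs into `card_posType_family_le_rank`, so `N⁺ = ∑ corank ≤ rank B`; then `Z₊ = 2N⁺` by `Inertia.global_index_formula`.)
RESIDUAL HYPOTHESIS (desk R3004): definite type at every positive root; a root with a NEUTRAL kernel vector (`P_u′(t) = 0`, e.g. a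
tangential touching of corank one) is outside the theorem.  Located: no maximiser found by the cell's zero-forcing instrument for this
word (m = 2, 3, 4; seven supports) has a degenerate root — all roots simple, hence definite; nothing is claimed for neutral roots.
[folklore] -/
theorem card_posRoots_le_two_mul_of_definite (A J B : Matrix (Fin m) (Fin m) ℝ) (hA : A.PosDef) (hJ : J.IsSymm) (hB : B.PosDef)
    (d₀ e : ℕ) (he : 0 < e)
    (htype : ∀ t : ℝ, 0 < t → (∑ k : Fin 3, t ^ (![d₀, d₀ + e, d₀ + 3 * e] k) • (![A, J, B] k)).det = 0 →
      (∀ u : Fin m → ℝ, (∑ k : Fin 3, t ^ (![d₀, d₀ + e, d₀ + 3 * e] k) • (![A, J, B] k)) *ᵥ u = 0 → u ≠ 0 →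
        (derivative (∑ k : Fin 3, C (u ⬝ᵥ ((![A, J, B] k) *ᵥ u)) * (X : ℝ[X]) ^ (![d₀, d₀ + e, d₀ + 3 * e] k))).eval t < 0) ∨
      (∀ u : Fin m → ℝ, (∑ k : Fin 3, t ^ (![d₀, d₀ + e, d₀ + 3 * e] k) • (![A, J, B] k)) *ᵥ u = 0 → u ≠ 0 →
        0 < (derivative (∑ k : Fin 3, C (u ⬝ᵥ ((![A, J, B] k) *ᵥ u)) * (X : ℝ[X]) ^ (![d₀, d₀ + e, d₀ + 3 * e] k))).eval t)) :
    Multiset.card ((Matrix.det (∑ k : Fin 3, ((X : ℝ[X]) ^ (![d₀, d₀ + e, d₀ + 3 * e] k)) • (![A, J, B] k).map C)).roots.filter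
        (fun t => 0 < t)) ≤ 2 * m := by
  classical
  set dv : Fin 3 → ℕ := ![d₀, d₀ + e, d₀ + 3 * e] with hdv
  set Sv : Fin 3 → Matrix (Fin m) (Fin m) ℝ := ![A, J, B] with hSv
  have hAs : A.IsSymm := by
    have h1 := hA.1; unfold Matrix.IsHermitian at h1
    rwa [Matrix.conjTranspose_eq_transpose_of_trivial] at h1
  have hBs : B.IsSymm := by
    have h1 := hB.1; unfold Matrix.IsHermitian at h1
    rwa [Matrix.conjTranspose_eq_transpose_of_trivial] at h1
  have hS : ∀ k, (Sv k).IsSymm := by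
    intro k; fin_cases k
    · exact hAs
    · exact hJ
    · exact hBs
  have hmin : ∀ l : Fin 3, l ≠ 0 → dv 0 < dv l := by
    intro l hl; fin_cases l
    · exact absurd rfl hl
    · show d₀ < d₀ + e; omega
    · show d₀ < d₀ + 3 * e; omega
  have hmax : ∀ l : Fin 3, l ≠ 2 → dv l < dv 2 := by
    intro l hl; fin_cases l
    · show d₀ < d₀ + 3 * e; omega
    · show d₀ + e < d₀ + 3 * e; omega
    · exact absurd rfl hl
  have h0 : (Sv 0).det ≠ 0 := by show A.det ≠ 0; exact hA.det_pos.ne'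
  have h2 : (Sv 2).det ≠ 0 := by show B.det ≠ 0; exact hB.det_pos.ne'
  let negType : ℝ → Prop := fun t => ∀ u : Fin m → ℝ, (∑ k, t ^ dv k • Sv k) *ᵥ u = 0 → u ≠ 0 →
    (derivative (∑ k, C (u ⬝ᵥ (Sv k *ᵥ u)) * (X : ℝ[X]) ^ dv k)).eval t < 0
  obtain ⟨hidx, -, hsum⟩ := Inertia.global_index_formula dv Sv hS 0 2 hmin hmax h0 h2 htype negType
    (fun t _ _ => Iff.rfl)
  have hνA : Fintype.card {j // (Inertia.isHermitian_of_isSymm (hS 0)).eigenvalues j < 0} = 0 := by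
    rw [Fintype.card_eq_zero_iff]
    refine ⟨fun ⟨j, hj⟩ => ?_⟩
    have hp : 0 < (Inertia.isHermitian_of_isSymm (hS 0)).eigenvalues j := hA.eigenvalues_pos j
    linarith
  have hνB : Fintype.card {j // (Inertia.isHermitian_of_isSymm (hS 2)).eigenvalues j < 0} = 0 := by
    rw [Fintype.card_eq_zero_iff]
    refine ⟨fun ⟨j, hj⟩ => ?_⟩
    have hp : 0 < (Inertia.isHermitian_of_isSymm (hS 2)).eigenvalues j := hB.eigenvalues_pos j
    linarith
  rw [hνA, hνB, zero_add, zero_add] at hidx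
  set P := Matrix.det (∑ k, ((X : ℝ[X]) ^ dv k) • (Sv k).map C) with hP
  set q : ℝ → Prop := fun t => 0 < t ∧ ¬ negType t with hq
  -- `N⁺ = ∑ corank` over the distinct positive-type roots
  have hdef : ∀ t ∈ P.roots.toFinset.filter q, ∀ v : Fin m → ℝ, (∑ k, t ^ dv k • Sv k) *ᵥ v = 0 → v ≠ 0 →
      (derivative (∑ k, C (v ⬝ᵥ (Sv k *ᵥ v)) * (X : ℝ[X]) ^ dv k)).eval t ≠ 0 := by
    intro t ht v hv hv0
    obtain ⟨hmem, htq⟩ := Finset.mem_filter.mp ht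
    obtain ⟨-, hroot⟩ := (Polynomial.mem_roots').mp (Multiset.mem_toFinset.mp hmem)
    have hdet : (∑ k, t ^ dv k • Sv k).det = 0 := by
      have h1 : P.eval t = 0 := hroot
      rwa [hP, DefiniteMoments.eval_det_pencil] at h1
    rcases htype t htq.1 hdet with h | h
    · exact ne_of_lt (h v hv hv0)
    · exact ne_of_gt (h v hv hv0)
  have hN : ∑ t ∈ P.roots.toFinset.filter q, (Fintype.card (Fin m) - (∑ k, t ^ dv k • Sv k).rank)
      = Multiset.card (P.roots.filter q) := Inertia.sum_corank_eq_card_roots_filter dv Sv hS q hdef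
  -- positive type at every root of `T`
  set T := P.roots.toFinset.filter q with hTdef
  have hTpos : ∀ t ∈ T, 0 < t := fun t ht => (Finset.mem_filter.mp ht).2.1
  have hTtype : ∀ t ∈ T, ∀ u : Fin m → ℝ, (∑ k, t ^ dv k • Sv k) *ᵥ u = 0 → u ≠ 0 →
      0 < (derivative (∑ k, C (u ⬝ᵥ (Sv k *ᵥ u)) * (X : ℝ[X]) ^ dv k)).eval t := by
    intro t ht u hu hu0
    obtain ⟨hmem, htq⟩ := Finset.mem_filter.mp ht
    obtain ⟨-, hroot⟩ := (Polynomial.mem_roots').mp (Multiset.mem_toFinset.mp hmem)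
    have hdet : (∑ k, t ^ dv k • Sv k).det = 0 := by
      have h1 : P.eval t = 0 := hroot
      rwa [hP, DefiniteMoments.eval_det_pencil] at h1
    rcases htype t htq.1 hdet with hneg | hposT
    · exact absurd hneg htq.2
    · exact hposT u hu hu0
  -- an orthogonal kernel family at each root of `T`, for the form `Φ_t = B − A/(2 t^{3e})`
  have hfam : ∀ t : T, ∃ v : Fin (m - (∑ k, (t : ℝ) ^ dv k • Sv k).rank) → (Fin m → ℝ),
      (∀ j, (∑ k, (t : ℝ) ^ dv k • Sv k) *ᵥ v j = 0) ∧ (∀ j, v j ≠ 0) ∧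
      ∀ j j', j ≠ j' → v j ⬝ᵥ ((B - (1 / (2 * (((t : ℝ) ^ e) ^ 3))) • A) *ᵥ v j') = 0 := by
    intro t
    refine exists_kernel_orthogonal_family _ _ ?_
    unfold Matrix.IsSymm
    rw [Matrix.transpose_sub, Matrix.transpose_smul, hAs, hBs]
  choose v hv0 hvne hvorth using hfam
  -- the index type: pairs (root, basis index)
  let Idx := Σ t : T, Fin (m - (∑ k, (t : ℝ) ^ dv k • Sv k).rank)
  have hcard : Fintype.card Idx = ∑ t ∈ T, (Fintype.card (Fin m) - (∑ k, t ^ dv k • Sv k).rank) := by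
    rw [Fintype.card_sigma]
    simp only [Fintype.card_fin]
    exact (Finset.sum_coe_sort T (fun t => m - (∑ k, t ^ dv k • Sv k).rank))
  have hbound : Fintype.card Idx ≤ B.rank := by
    refine card_posType_family_le_rank (I := Idx) A J B hA.posSemidef hJ hB.posSemidef e (fun p => (p.1 : ℝ))
      (fun p => hTpos p.1 p.1.2) he (fun p => v p.1 p.2) (fun p => reduced_kernel A J B d₀ e (hTpos p.1 p.1.2) _ (hv0 p.1 p.2))
      ?_ ?_
    · intro p
      have ht := hTpos p.1 p.1.2
      have hpos := hTtype p.1 p.1.2 (v p.1 p.2) (hv0 p.1 p.2) (hvne p.1 p.2)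
      have heq := rayleigh_deriv_eq A J B d₀ e ht _ (hv0 p.1 p.2)
      have h1 : 0 < (p.1 : ℝ) * (derivative (∑ k : Fin 3, C (v p.1 p.2 ⬝ᵥ ((![A, J, B] k) *ᵥ v p.1 p.2)) *
          (X : ℝ[X]) ^ (![d₀, d₀ + e, d₀ + 3 * e] k))).eval (p.1 : ℝ) := mul_pos ht hpos
      rw [heq] at h1
      have h2 : 0 < (e : ℝ) * (p.1 : ℝ) ^ d₀ := mul_pos (Nat.cast_pos.mpr he) (pow_pos ht _)
      by_contra hcon
      push Not at hcon
      have h3 : 2 * (((p.1 : ℝ)) ^ e) ^ 3 * (v p.1 p.2 ⬝ᵥ (B *ᵥ v p.1 p.2)) - v p.1 p.2 ⬝ᵥ (A *ᵥ v p.1 p.2) ≤ 0 := by linarith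
      have := mul_nonpos_of_nonneg_of_nonpos h2.le h3
      linarith
    · rintro ⟨t, j⟩ ⟨t', j'⟩ hne htt'
      simp only at htt'
      have htt : t = t' := Subtype.ext htt'
      subst htt
      have hjj : j ≠ j' := fun h => hne (by subst h; rfl)
      have h := hvorth t j j' hjj
      have ht := hTpos t.1 t.2
      have hc : (2 * (((t : ℝ)) ^ e) ^ 3) ≠ 0 := by positivity
      rw [Matrix.sub_mulVec, Matrix.smul_mulVec, dotProduct_sub, dotProduct_smul, smul_eq_mul, sub_eq_zero] at h
      rw [h]
      field_simp
  -- assemble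
  have hBm : B.rank ≤ m := (Matrix.rank_le_width B).trans le_rfl
  rw [← hsum]
  have hNle : Multiset.card (P.roots.filter q) ≤ m := by
    rw [← hN, ← hcard]
    exact hbound.trans hBm
  have hidx' : Multiset.card (P.roots.filter fun t => 0 < t ∧ negType t) = Multiset.card (P.roots.filter q) := hidx.symm
  rw [hidx']
  omega

end Definite

end TwoSidedThree

end Summit.ValiantsHypothesis.ValiantsHypothesis.Theorems.KPlusLogSqLaw.TowerGraft
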